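import Summits.QuantumFields.YangMills.Theses.LangevinControlUV
import Literature.MathematicalPhysics.QuantumFieldTheory.DiagonalLatticeClustering

/-!
# Birth skeleton (BC3) for crux `GapToContinuum` (stmt-QuantumFields-8896) — `Lines/birth.lean`

Registrar: `planner-skel-stmt-QuantumFields-8896-0` (skeleton-register one-shot; route
`route-QuantumFields-LangevinControlUV`, re-audit bin REPAIRABLE), 2026-08-17.
**SHAPE CERTIFICATE — read §Status before seating anyone on a stub.**

Crux (route file `Theses/LangevinControlUV.lean`, decl
`Summit.QuantumFields.YangMills.Theses.LangevinControlUV.GapToContinuum`):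
`∀ G r sch T Δ, 0 < Δ → IsYangMillsFor r sch T → HasLatticeMassGap r sch Δ → T.HasMassGap Δ`.

## The two stubs = the two missing uniformities of the defect map

The standing analysis of this crux (`Cruxes/GapToContinuum/STRATEGY-CENSUS.md` §1; five line leads,
two triagers, three ideators, the standing `Disproof.lean`) locates ALL of its difficulty in two
independent uniformities that the TYPE of `HasLatticeMassGap` (`∀ A B, ∃ C, ∀ᶠ k, …`: pair-dependent
constant AND pair-dependent threshold, sup-norm currency, all tori `S ≥ L_k`) does not supply.  This
skeleton types exactly those two as its two stubs — it cuts BETWEEN them — so that the composition is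
the crux BY NAME and the glue is the tree's transfer theorem (R5):

* `stub_thresholdUniformity` — **D2, threshold uniformity** (lattice content only): along an
  `IsYangMillsFor` scheme, per-pair clustering `∀ A B ∃ C ∀ᶠ k` upgrades to ONE threshold
  `∃ k₀ ∀ A B ∃ C ∀ k ≥ k₀` — verbatim the pair-uniform antecedent of OneCertifiedCube's re-typed item
  stmt-QuantumFields-16126.  Why it might fail: Baire/Osgood uniformise thresholds only on
  fixed-support Banach spaces of cylinder observables (lead c1, `NOTES-c1.md`); the step-`k`
  approximants of continuum quantities range over the `k`-GROWING family of translated product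
  species `A·(B∘τ_z)`, `|z| ≲ diam(supp)/a_k`, and an adversarial scheme may have observable-dependent
  onset of clustering along infinitely many `k`.  True for the intended weak-coupling schemes, where
  `k₀` comes from pair-independent eventualities (16126 docstring: `a_k ≤ ℓ`, `(8n+7)ℓ ≤ a_k L_k`).
* `stub_uniformTransfer` — **D3b (with its facet D1), the currency / own-torus transfer**: along an
  `IsYangMillsFor` scheme, the PAIR-UNIFORM sup-norm lattice gap gives diagonal clustering of the
  lattice `n`-point functions of the smeared renormalised fields on the scheme's OWN tori in OS
  currency, `sch.HasDiagClustering r Δ` (tree `DiagonalLatticeClustering.lean`: one slab-ordered real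
  factor datum at a time, FREE constant, slack `ε`, eventually in `k` — the WEAKEST lattice clause
  that transfers, R5).  It is stmt-16126 without `sch.HasWeakCouplingLimit`, concluded one step
  earlier (lattice side).  Why it might fail: absolute per-pair constants vs renormalised composites
  (`c_s(k)` free in `sch`); the thermal wrap-around term on the time-periodic own torus (finite-horizon
  RP log-convexity loses `(C_k/osVar)^{2^{-J}}`, `2^J ≍ a_k L_k / t`, so a growth clause
  `log C_k = o(a_k L_k)` is needed and the universally quantified `sch` carries none;
  `TriageThermalToy`, `TriageNormGapThermalToy`); odd-torus link reflection positivity needs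
  `0 ≤ β_k` (D1, `wilsonExpectation_oddReflectionPositive`) while `sch.β` is a free real sequence.
* `GapToContinuum_of` — the composition: D2-upgrade, then D3b-transfer, then the landed
  `IsYangMillsFor.hasMassGap_of_hasDiagClustering` (R5; Glimm–Jaffe §6.1 Thm 6.1.3 form; lineage
  p124697 + p124879, interface `DiagonalLatticeClustering`); registered form = stubs BY NAME inside
  the proof; the glue with the stub statements as explicit hypotheses is the `sorry`-free `example`
  after it (a REAL proof: nothing but R5 and application).

## Status (honest): crux MISSTATED AS TYPED — this file certifies shape, not provability

Both stubs are believed UNPROVABLE for the universally quantified `sch` of the typed crux, and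
unrefutable in practice (every Wilson model evaluable in the tree — trivial `G`, `β ≡ 0` — is
ultralocal on `⁰𝒮` and satisfies both; `Disproof.lean` §2).  They are filed as the two NAMED lemmas
any proof of the typed text must contain — one per irreducible defect — not as an invitation to seat
a sixth lead: the census's door is a RE-TYPE of 8896 (R5 `GapToContinuumR`, `Retype.lean`; a
tenure / human verb, requested 2026-08-17), after which this skeleton is moot.  The registered lines
`Sketch`, `SketchIdeator4`, `SketchIdeator5` (all dead) each had ONE load-bearing stub equivalent to
the crux (`gapToContinuum_iff_diagonalCore`, p125787); this split differs by cutting between the two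
uniformities, so neither stub is the crux: `stub_uniformTransfer` is strictly weaker (stronger
antecedent), `stub_thresholdUniformity` concludes a lattice statement, and the cheap probes
`stub → GapToContinuum`, `stub → YangMills` (`first | exact? | simpa | … | aesop`) fail for both
(registrar folder `bc/GapToContinuum_probe.lean`; `Lines/birth.md`).

## Disproof used

* `Theorems/GapToContinuum/Negative/WithoutIsYangMillsFor.lean` (p120966,
  `gapToContinuum_false_without_isYangMillsFor_of_gapless`): any proof must use `IsYangMillsFor` —
  the line uses it in the glue (R5 reads `T` off the lattice `n`-point functions) and carries it in
  both stubs.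
* `Theorems/GapToContinuum/Negative/HeavyProductLeak.lean` (p120725, `not_heavyKetsProductClosed`):
  the abstract product-closure strengthening is false — neither stub asserts product/sandwich closure
  of heavy kets; D2 is a threshold uniformity over ALL pairs (product species included), not a
  derivation of multi-leg data from one-leg data.
* `Disproof.lean` §3: `HasLatticeMassGap` is load-bearing — consumed by `stub_thresholdUniformity`;
  `0 < Δ` is decoration — carried through, unused by the glue.

`lean check`: rc 0; sorries = 2 = stubs (`stub_thresholdUniformity`, `stub_uniformTransfer`),
zero elsewhere.  Namespace `Summit.QuantumFields.YangMills.Cruxes.GapToContinuum.Birth`.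
-/

noncomputable section

namespace Summit.QuantumFields.YangMills.Cruxes.GapToContinuum.Birth

open Filter Topology
open Literature.MathematicalPhysics.QuantumFieldTheory
open Summit.QuantumFields.YangMills.Theses.LangevinControlUV

/-- **Stub D2 — threshold uniformity (OPEN as typed).**  Along a scheme that IS the Wilson continuum
limit `T`, the per-pair lattice mass gap (`∀ A B, ∃ C, ∀ᶠ k`) upgrades to a PAIR-UNIFORM threshold
(`∃ k₀, ∀ A B, ∃ C, ∀ k ≥ k₀`), constants still per pair, on all tori `S ≥ L_k` and all `n ≤ S`. -/
theorem stub_thresholdUniformity :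
    ∀ (G : Type) [Group G] [TopologicalSpace G] [IsTopologicalGroup G] [CompactSpace G]
      [MeasurableSpace G] [BorelSpace G] (r : LatticeRep G) (sch : SpeciesScheme (YMSpecies G))
      (T : OSData (YMSpecies G) 4) (Δ : ℝ), 0 < Δ → IsYangMillsFor r sch T →
        HasLatticeMassGap r sch Δ →
        ∃ k₀ : ℕ, ∀ A B : YMSpecies G, ∃ C : ℝ, ∀ k : ℕ, k₀ ≤ k → ∀ S : ℕ, sch.L k ≤ S →
          ∀ n : ℕ, n ≤ S →
            |latticeConnectedCorr r.ρ (sch.β k) (2 * S + 1) A.F B.F n| ≤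
              C * Real.exp (-(Δ * (sch.a k * n))) := by
  sorry

/-- **Stub D3b — uniform transfer into diagonal OS currency (OPEN as typed).**  Along a scheme that
IS the Wilson continuum limit `T`, the pair-uniform sup-norm lattice mass gap gives diagonal
clustering at rate `Δ` of the lattice `n`-point functions of the smeared renormalised fields on the
scheme's own tori (`SpeciesScheme.HasDiagClustering`: free constant per slab-ordered real factor
datum, slack `ε`, eventually in `k`). -/
theorem stub_uniformTransfer :
    ∀ (G : Type) [Group G] [TopologicalSpace G] [IsTopologicalGroup G] [CompactSpace G]
      [MeasurableSpace G] [BorelSpace G] (r : LatticeRep G) (sch : SpeciesScheme (YMSpecies G))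
      (T : OSData (YMSpecies G) 4) (Δ : ℝ), 0 < Δ → IsYangMillsFor r sch T →
        (∃ k₀ : ℕ, ∀ A B : YMSpecies G, ∃ C : ℝ, ∀ k : ℕ, k₀ ≤ k → ∀ S : ℕ, sch.L k ≤ S →
          ∀ n : ℕ, n ≤ S →
            |latticeConnectedCorr r.ρ (sch.β k) (2 * S + 1) A.F B.F n| ≤
              C * Real.exp (-(Δ * (sch.a k * n)))) →
        sch.HasDiagClustering r Δ := by
  sorry

/-- **Composition**: the two stubs BY NAME and the tree's diagonal transfer theorem
`IsYangMillsFor.hasMassGap_of_hasDiagClustering` (R5) give the crux BY NAME — threshold uniformity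
(D2), then the uniform transfer (D3b), then R5.  (Registered form: hypotheses discharged inside the
proof by the declared stubs, as `ledger skeleton check` requires; the `example` right below is the
same glue with the two stub statements as explicit hypotheses and NO reference to the stubs, i.e.
the composition is a real, `sorry`-free proof.) -/
theorem GapToContinuum_of :
    Summit.QuantumFields.YangMills.Theses.LangevinControlUV.GapToContinuum := by
  intro G _ _ _ _ _ _ r sch T Δ hΔ hYM hlat
  exact hYM.hasMassGap_of_hasDiagClustering
    (stub_uniformTransfer G r sch T Δ hΔ hYM (stub_thresholdUniformity G r sch T Δ hΔ hYM hlat))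

/-- **The glue alone, `sorry`-free**: `stub_thresholdUniformity`'s statement → `stub_uniformTransfer`'s
statement → the crux (verbatim signatures; this `example` does not mention the stubs, so Lean would
flag any `sorry` here — there is none). -/
example
    (h₁ : ∀ (G : Type) [Group G] [TopologicalSpace G] [IsTopologicalGroup G] [CompactSpace G]
      [MeasurableSpace G] [BorelSpace G] (r : LatticeRep G) (sch : SpeciesScheme (YMSpecies G))
      (T : OSData (YMSpecies G) 4) (Δ : ℝ), 0 < Δ → IsYangMillsFor r sch T →
        HasLatticeMassGap r sch Δ →
        ∃ k₀ : ℕ, ∀ A B : YMSpecies G, ∃ C : ℝ, ∀ k : ℕ, k₀ ≤ k → ∀ S : ℕ, sch.L k ≤ S →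
          ∀ n : ℕ, n ≤ S →
            |latticeConnectedCorr r.ρ (sch.β k) (2 * S + 1) A.F B.F n| ≤
              C * Real.exp (-(Δ * (sch.a k * n))))
    (h₂ : ∀ (G : Type) [Group G] [TopologicalSpace G] [IsTopologicalGroup G] [CompactSpace G]
      [MeasurableSpace G] [BorelSpace G] (r : LatticeRep G) (sch : SpeciesScheme (YMSpecies G))
      (T : OSData (YMSpecies G) 4) (Δ : ℝ), 0 < Δ → IsYangMillsFor r sch T →
        (∃ k₀ : ℕ, ∀ A B : YMSpecies G, ∃ C : ℝ, ∀ k : ℕ, k₀ ≤ k → ∀ S : ℕ, sch.L k ≤ S →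
          ∀ n : ℕ, n ≤ S →
            |latticeConnectedCorr r.ρ (sch.β k) (2 * S + 1) A.F B.F n| ≤
              C * Real.exp (-(Δ * (sch.a k * n)))) →
        sch.HasDiagClustering r Δ) :
    Summit.QuantumFields.YangMills.Theses.LangevinControlUV.GapToContinuum := by
  intro G _ _ _ _ _ _ r sch T Δ hΔ hYM hlat
  exact hYM.hasMassGap_of_hasDiagClustering (h₂ G r sch T Δ hΔ hYM (h₁ G r sch T Δ hΔ hYM hlat))

/-- Signature match: the stubs instantiate the glue's hypotheses (kernel-checked). -/
example : Summit.QuantumFields.YangMills.Theses.LangevinControlUV.GapToContinuum := GapToContinuum_of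

end Summit.QuantumFields.YangMills.Cruxes.GapToContinuum.Birth

end
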